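import Summits.QuantumFields.YangMills.Theorems.BalabanUVNodesN21LowCentreEndChartLetter
import Summits.QuantumFields.YangMills.Theorems.BalabanUVNodesN21ShellSplitOfRecord13CoPHChart
import Summits.QuantumFields.YangMills.Theorems.BalabanUVNodesN21ResponseRoadFrameTransfer

/-!
# N21 (NE7c) · THE [LF-II] §1-LETTERS END ON THE EXPONENTIAL `SU(N)` BLOCK CHART, I: the low-centre END (p590709 ★★★)
# transported to the FLAT cut chart law on pub-balaban's `BlockChartSU N b` (the frame of dag-n21-w2's JUNCTION №3 `hchart`)

Width seat pub-ymgap-dag-n21-w1 (g2; director-ym №197 ∕ HUMAN RULING D-0149), node N21 = NE7c (single-run shell-weight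
bound, NOT PRINTED in [Bałaban 1983–89], NOT proved), lane K3⁷ `SpineGivenEndpointR13SepCoPH` (stmt-QuantumFields-20544,
`--kind proof --supports … --as helper`).  Ninth file of the seat's item-1 chain; the successor piece named by g0's
NO-SUCCESSOR trigger (t3) «junction [LF-II]-§1 END ∘ exponential chart», live since dag-n21-w2's p600281 landed.
Consumes BY NAME: this seat's p590709 ★★★ `slotAntiConcentration_restrict_of_sect1Letters` (the END in the flat product
frame `X × (κ → ℝ)`), dag-n21-w2's p600281 `slotAC_blockFibreLaw_of_chartAC` ∕ `slotAC_termFibreLaw_of_chartAC` (the block ∕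
term fibre law of record through the exponential `SU(N)` block chart), dag-n21-w3's p602847 `measurePreserving_unflat` ∕
`slotAntiConcentration_of_dirac_prod` ∕ `slotAntiConcentration_blockChartSU_of_unflat` (the measure-preserving un-flattening
`(↥b × Fin d_N → ℝ) → BlockChartSU N b` and the transport of (M1) along it — theirs, cited, not retyped), pub-balaban's
chart modules (`BlockChartSU`, `expFibreChartSU`, `chartWeightSU`, `expJacWeightSU`, `kappaSU`, `windowSU`, `blockLaw` —
credited), dag-n21-d's Defs (`blockFibreLawOfDatum₉`, `termFibreLawOfDatum₉`, `blockReading`) and `T4ShellMeasureDet`'s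
`withDensity_map_eq_map_withDensity_comp`.  THEOREMS ONLY: 0 `def`, 0 `sorry`; count-neutral.

WHY.  The ENDs p590709 ∕ p592783 conclude (M1) for a cut log-concave law `𝟙_K e^{−φ} d(ζ × Leb)` on the flat frame
`X × (κ → ℝ)`.  JUNCTION №3 wants (M1) for the CHART LAW
`vol.withDensity (chartWeightSU b S (expJacWeightSU κ_N) · R ∘ expFibreChartSU b c)` on pub-balaban's block chart space
`BlockChartSU N b = ↥b → E_N` (`E_N = EuclideanSpace ℝ (Fin d_N)`, `d_N = dim 𝔰𝔲(N) = N² − 1`), with the statistic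
`blockReading u b x ∘ expFibreChartSU b c`.  The bridge is the LINEAR, measure-preserving un-flattening
`(↥b × Fin d_N → ℝ) → BlockChartSU N b` (dag-n21-w3's file 10 §5 convention and p602847): along it (M1) moves
(`slotAntiConcentration_blockChartSU_of_unflat`), and convexity, the (1.2) expansion, the printed rows and the radial binders
move verbatim (the map is linear; `Σ_q v_q² = Σ_{b′} ‖v b′‖²`); the sup norm of the flat frame and the block chart norm
`max_{b′} ‖z b′‖_{E_N}` differ by at most `√d_N` (§0), so an `L`-Lipschitz statistic for the chart norm is
`√d_N·L`-Lipschitz in the frame — the ONLY price: the clause reads `16·W·d·(100M)^{d+1}·(d_N·L²) ≤ γ₀(θ(1−ρ−σ))²`, displayed.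

WHAT IS PROVED HERE ([folklore] + [textbook] + composition BY NAME; companion `…LowCentreEndAtSUNBlockChartRecord` carries
the chart-letter species ★★★★, the junctions AT THE RECORD's block ∕ term fibre laws through p600281, and the A6 witnesses).
* §0 `norm_le_sqrt_dimSU_mul_norm_flatten` · `sum_sq_flatten` · `slotAntiConcentration_congr_support` ((M1) for
  `ν.withDensity (A.indicator f)` depends on the statistic only through its values on `A`) · `measurePreserving_snd_dirac_unit`.
* §1 ★★★ `slotAntiConcentration_blockChartSU_of_sect1Letters`: p590709's END AT THE CHART SPACE — kept CONVEX cuts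
  `K ∋ 0`, CONVEX exponent with the (1.2) expansion, rows `Ineq19 (Q v) (Σ_{b′} ‖v b′‖²) γ₀ d M` ∕ `Ineq16`, remainder value
  bound, `L`-Lipschitz statistic (chart norm) with core reading `U 0 ≤ σθ`, ONE clause (with the factor `d_N`),
  `henv`∕`hRT` radial in `l • z`, odds `hQ` ⇒ `SlotAntiConcentration ((vol.withDensity 𝟙_K e^{−φ})|({U<θ}∩C)) U θ ρ
  (3(#b·d_N+1)(1+Q)∕(κ₀(1−ρ)))` (`2 ≤ N`, `b` nonempty).

HONEST FRAMING.  [folklore] measure transport BY NAME + [textbook] convexity ∕ real arithmetic + composition BY NAME; the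
located letters — the cut log-concave presentation of the chart density (companion file's `hdens`), the identification of
the rows `Ineq16`∕`Ineq19` with the N21 slot's block action — are HYPOTHESES; nothing of Bałaban's asserted; NE7c NOT PRINTED ∕ NOT proved; N21 NOT discharged;
K3⁷ NOT claimed; counts unmoved (typed 28∕28 · discharged 5∕27); never a count claim; one finite 𝕋⁴ at fixed ε — R4 would
close only the conditional finite-𝕋⁴ rung `BalabanLadder.UV`, NOT the Yang–Mills mass gap (Clay); nothing about ℝ⁴ ∕ OS.
-/

set_option autoImplicit false

noncomputable section

open MeasureTheory Set Function Finset Metric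
open scoped ENNReal BigOperators

namespace Summit.QuantumFields.YangMills.Theorems.N21LowCentreEndAtSUNBlockChart

open Literature.MathematicalPhysics.QuantumFieldTheory.Balaban1983to89
open Literature.MathematicalPhysics.QuantumFieldTheory.Balaban1983to89.T4Continuum
open Literature.MathematicalPhysics.QuantumFieldTheory.Balaban1983to89.Node00 hiding dimSU
open Literature.MathematicalPhysics.QuantumFieldTheory.Balaban1983to89.T4ShellMeasure (SlotAntiConcentration)
open Literature.MathematicalPhysics.QuantumFieldTheory.Balaban1983to89.T4ShellMeasureDet (withDensity_map_eq_map_withDensity_comp)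
open Literature.MathematicalPhysics.QuantumFieldTheory.Balaban1983to89.B16Sect1Wilson (Ineq16 Ineq19)
open Summit.QuantumFields.BalabanUV.T4Continuum.ShellMeasureExpChartSUN (ChartSU BlockChartSU dimSU dimSU_eq)
open Summit.QuantumFields.YangMills.Theorems.N21LowCentreEndSect1Letters (slotAntiConcentration_restrict_of_sect1Letters)
open Summit.QuantumFields.YangMills.Theorems.N21ResponseRoadFrameTransfer
  (measurePreserving_unflat slotAntiConcentration_of_dirac_prod slotAntiConcentration_blockChartSU_of_unflat)

/-! ## §0  The flat coordinates of the block chart space: norms, sums of squares, supports, the `dirac ()` factor -/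

section Flatten

variable {N : ℕ} {P : Params} {j : ℕ}

/-- the block chart norm is at most `√d_N` times the sup norm of the flat coordinates
(`‖z b′‖_{E_N} = √(Σ_a (z b′)_a²) ≤ √d_N · max |(z b′)_a|`). [folklore] -/
theorem norm_le_sqrt_dimSU_mul_norm_flatten (b : Finset (PBond P j)) (z : BlockChartSU N b) :
    ‖z‖ ≤ Real.sqrt (dimSU N) * ‖(fun q : ↥b × Fin (dimSU N) => z q.1 q.2)‖ := by
  set f : ↥b × Fin (dimSU N) → ℝ := fun q => z q.1 q.2 with hf
  have h0 : 0 ≤ Real.sqrt (dimSU N) * ‖f‖ := by positivity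
  refine (pi_norm_le_iff_of_nonneg h0).mpr fun i => ?_
  rw [EuclideanSpace.norm_eq]
  calc Real.sqrt (∑ a, ‖z i a‖ ^ 2) ≤ Real.sqrt (∑ _a : Fin (dimSU N), ‖f‖ ^ 2) := by
        refine Real.sqrt_le_sqrt (Finset.sum_le_sum fun a _ => ?_)
        have h := norm_le_pi_norm f (i, a)
        exact pow_le_pow_left₀ (norm_nonneg _) h 2
    _ = Real.sqrt (dimSU N) * ‖f‖ := by
        rw [Finset.sum_const, Finset.card_univ, Fintype.card_fin, nsmul_eq_mul,
          Real.sqrt_mul (Nat.cast_nonneg _), Real.sqrt_sq (norm_nonneg _)]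

/-- the sum of squares of the flat coordinates is the sum over the bonds of the squared `E_N`-norms. [folklore] -/
theorem sum_sq_flatten (b : Finset (PBond P j)) (z : BlockChartSU N b) :
    ∑ q : ↥b × Fin (dimSU N), (z q.1 q.2) ^ 2 = ∑ i : ↥b, ‖z i‖ ^ 2 := by
  rw [Fintype.sum_prod_type]
  exact Finset.sum_congr rfl fun i _ => (EuclideanSpace.real_norm_sq_eq (z i)).symm

/-- **(M1) FOR A LAW CARRIED BY `A` DEPENDS ON THE STATISTIC ONLY THROUGH ITS VALUES ON `A`**: for
`ν.withDensity (A.indicator f)`, two statistics that agree on `A` have the same shell mass. [folklore] -/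
theorem slotAntiConcentration_congr_support {Ω : Type*} [MeasurableSpace Ω] (ν : Measure Ω) {A : Set Ω}
    (hA : MeasurableSet A) (f : Ω → ℝ≥0∞) {u u' : Ω → ℝ} (h : Set.EqOn u u' A) {θ ρ D : ℝ}
    (hu : SlotAntiConcentration (ν.withDensity (A.indicator f)) u θ ρ D) :
    SlotAntiConcentration (ν.withDensity (A.indicator f)) u' θ ρ D := by
  have hμ : (ν.restrict A).withDensity f = ((ν.restrict A).withDensity f).restrict A := by
    rw [restrict_withDensity hA, Measure.restrict_restrict hA, Set.inter_self]
  have key : ∀ T : Set Ω, ((ν.restrict A).withDensity f) T = ((ν.restrict A).withDensity f) (T ∩ A) := fun T => by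
    conv_lhs => rw [hμ]
    exact Measure.restrict_apply' hA
  have hset : {x | θ * (1 - ρ) ≤ u' x ∧ u' x < θ} ∩ A = {x | θ * (1 - ρ) ≤ u x ∧ u x < θ} ∩ A := by
    ext x
    simp only [Set.mem_inter_iff, Set.mem_setOf_eq]
    constructor
    · rintro ⟨hx, hxA⟩
      exact ⟨by rwa [h hxA], hxA⟩
    · rintro ⟨hx, hxA⟩
      exact ⟨by rwa [← h hxA], hxA⟩
  unfold SlotAntiConcentration at hu ⊢
  rw [withDensity_indicator hA] at hu ⊢
  rw [key {x | θ * (1 - ρ) ≤ u' x ∧ u' x < θ}, hset, ← key]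
  exact hu

/-- the second projection `Unit × Y → Y` pushes `(dirac ()) × ν` to `ν`. [folklore] -/
theorem measurePreserving_snd_dirac_unit {Y : Type*} [MeasurableSpace Y] (ν : Measure Y) [SFinite ν] :
    MeasurePreserving (Prod.snd : Unit × Y → Y) ((Measure.dirac ()).prod ν) ν := by
  refine ⟨measurable_snd, ?_⟩
  rw [Measure.dirac_prod, Measure.map_map measurable_snd measurable_prodMk_left]
  exact Measure.map_id'

end Flatten

/-! ## §1  ★★★ The [LF-II] §1-letters END at the flat chart law on `BlockChartSU N b` -/

section End

variable {N : ℕ} {P : Params} {j : ℕ}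

/-- ★★★ **(M1) ON THE CUT CHART LAW, AT [LF-II] §1's LETTERS, ON THE `SU(N)` BLOCK CHART SPACE.**  p590709's END with
every binder stated on `BlockChartSU N b` (`2 ≤ N`, `b` nonempty): kept CONVEX cuts `K ∋ 0`, CONVEX exponent `φ` with the
(1.2) expansion `φ v = φ 0 + ½Q v + lin v + Vt v` on `K`, the PRINTED ROWS as hypotheses on the chart — (1.9)
`Ineq19 (Q v) (Σ_{b′} ‖v b′‖²) γ₀ d M`, (1.6) `Ineq16 (lin v) …` —, `|Vt v| ≤ W_V`, a statistic `L`-Lipschitz for the block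
chart norm with core reading `U 0 ≤ σθ`, the ONE clause `16·W·d·(100M)^{d+1}·(d_N·L²) ≤ γ₀·(θ(1−ρ−σ))²` (the flattening's
`√d_N` displayed), the envelope `henv` and radial transversality `hRT` along `l • z`, and the odds `hQ` ⇒
`SlotAntiConcentration ((vol.withDensity 𝟙_K e^{−φ})|({U<θ}∩C)) U θ ρ (3(#b·d_N+1)(1+Q)∕(κ₀(1−ρ)))`. [textbook] -/
theorem slotAntiConcentration_blockChartSU_of_sect1Letters (hN : 2 ≤ N) (b : Finset (PBond P j)) (hb : b.Nonempty)
    (K : Set (BlockChartSU N b)) (φ Qf lin Vt : BlockChartSU N b → ℝ)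
    (hg : Measurable fun z : BlockChartSU N b => K.indicator (fun w => ENNReal.ofReal (Real.exp (-φ w))) z)
    {U : BlockChartSU N b → ℝ} (hUm : Measurable U)
    {C Env : Set (BlockChartSU N b)} (hC : MeasurableSet C) (hEnv : MeasurableSet Env)
    {θ ρ σ κ₀ Q L γ₀ M B₃ M₀ A₀ p₀g Rk WV : ℝ} {d : ℕ}
    (hθ : 0 < θ) (hρ0 : 0 < ρ) (hρ1 : ρ < 1) (hρσ : ρ + σ ≤ 1) (hκ : 0 < κ₀) (hQ0 : 0 ≤ Q) (hL : 0 < L)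
    (hd : 1 ≤ d) (hM : 0 < M) (hγ₀ : 0 < γ₀)
    (hW : 0 ≤ 3 * B₃ * M₀ * A₀ ^ 2 * p₀g ^ 2 * Real.exp (-Rk) * (100 * M) ^ 4 + WV)
    (hK : Convex ℝ K) (hφ : ConvexOn ℝ K φ) (h0K : (0 : BlockChartSU N b) ∈ K)
    (hexp : ∀ v ∈ K, φ v = φ 0 + 1 / 2 * Qf v + lin v + Vt v)
    (h19 : ∀ v ∈ K, Ineq19 (Qf v) (∑ i, ‖v i‖ ^ 2) γ₀ d M)
    (h16 : ∀ v ∈ K, Ineq16 (lin v) B₃ M₀ A₀ p₀g Rk M)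
    (hV : ∀ v ∈ K, |Vt v| ≤ WV)
    (hU : ∀ a a' : BlockChartSU N b, U a - U a' ≤ L * ‖a - a'‖)
    (hUc : U 0 ≤ σ * θ)
    (hclause : 16 * (3 * B₃ * M₀ * A₀ ^ 2 * p₀g ^ 2 * Real.exp (-Rk) * (100 * M) ^ 4 + WV) * d
      * (100 * M) ^ (d + 1) * (dimSU N * L ^ 2) ≤ γ₀ * (θ * (1 - ρ - σ)) ^ 2)
    (henv : ∀ l ∈ Icc (1 - 1 / ((b.card : ℝ) * dimSU N + 1)) 1, ∀ z : BlockChartSU N b,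
      θ * (1 - ρ) ≤ U z → U z < θ → z ∈ C → l • z ∈ Env)
    (hRT : ∀ z : BlockChartSU N b, θ * (1 - ρ) ≤ U z → U z < θ → z ∈ C → ∀ s : ℝ, 1 ≤ s →
      θ * (1 - ρ) ≤ U (s • z) → U (s • z) < θ → s • z ∈ C → U z + κ₀ * (θ * (1 - ρ)) * (s - 1) ≤ U (s • z))
    (hQ : ((volume : Measure (BlockChartSU N b)).withDensity fun z =>
        K.indicator (fun w => ENNReal.ofReal (Real.exp (-φ w))) z) (Env \ ({z | U z < θ} ∩ C))
      ≤ ENNReal.ofReal Q * ((volume : Measure (BlockChartSU N b)).withDensity fun z =>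
        K.indicator (fun w => ENNReal.ofReal (Real.exp (-φ w))) z) ({z | U z < θ} ∩ C)) :
    SlotAntiConcentration
      (((volume : Measure (BlockChartSU N b)).withDensity fun z =>
          K.indicator (fun w => ENNReal.ofReal (Real.exp (-φ w))) z).restrict ({z | U z < θ} ∩ C))
      U θ ρ (3 * ((b.card : ℝ) * dimSU N + 1) * (1 + Q) / (κ₀ * (1 - ρ))) := by
  classical
  -- the flat frame `κ = ↥b × Fin d_N`, nonempty
  set m : ℕ := dimSU N with hm_def
  have hm : 0 < m := by
    rw [hm_def, dimSU_eq]
    have h4 : 4 ≤ N ^ 2 := by nlinarith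
    omega
  obtain ⟨i₀, hi₀⟩ := hb
  haveI : Nonempty (↥b × Fin m) := ⟨(⟨i₀, hi₀⟩, ⟨0, hm⟩)⟩
  -- the un-flattening and its elementary properties
  set uf : (↥b × Fin m → ℝ) → BlockChartSU N b :=
    fun w i => (WithLp.toLp 2 fun a : Fin m => w (i, a) : ChartSU N) with huf_def
  set fl : BlockChartSU N b → (↥b × Fin m → ℝ) := fun z q => z q.1 q.2 with hfl_def
  have hfl_uf : ∀ w, fl (uf w) = w := fun w => by
    funext q
    simp [hfl_def, huf_def]
  have huf_add : ∀ w w' : ↥b × Fin m → ℝ, uf (w + w') = uf w + uf w' := fun w w' => by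
    funext i; ext a; simp [huf_def]
  have huf_smul : ∀ (c : ℝ) (w : ↥b × Fin m → ℝ), uf (c • w) = c • uf w := fun c w => by
    funext i; ext a; simp [huf_def]
  have huf_zero : uf 0 = 0 := by
    funext i; ext a; simp [huf_def]
  have huf_sub : ∀ w w' : ↥b × Fin m → ℝ, uf (w - w') = uf w - uf w' := fun w w' => by
    rw [sub_eq_add_neg, huf_add, ← neg_one_smul ℝ w', huf_smul, neg_one_smul, ← sub_eq_add_neg]
  have hnorm : ∀ w : ↥b × Fin m → ℝ, ‖uf w‖ ≤ Real.sqrt m * ‖w‖ := fun w => by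
    have h := norm_le_sqrt_dimSU_mul_norm_flatten b (uf w)
    rwa [show (fun q : ↥b × Fin (dimSU N) => (uf w) q.1 q.2) = w from hfl_uf w] at h
  have hsumsq : ∀ w : ↥b × Fin m → ℝ, ∑ q, w q ^ 2 = ∑ i, ‖uf w i‖ ^ 2 := fun w =>
    sum_sq_flatten b (uf w)
  have hcard : (Fintype.card (↥b × Fin m) : ℝ) = (b.card : ℝ) * m := by
    rw [Fintype.card_prod, Fintype.card_coe, Fintype.card_fin, Nat.cast_mul]
  -- the frame map `e = uf ∘ snd` is measure preserving
  set e : Unit × (↥b × Fin m → ℝ) → BlockChartSU N b := fun q => uf q.2 with he_def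
  have he : MeasurePreserving e ((Measure.dirac ()).prod volume) volume :=
    (measurePreserving_unflat b).comp (measurePreserving_snd_dirac_unit _)
  have hem : Measurable e := he.measurable
  -- the cut event and the densities
  set gK : BlockChartSU N b → ℝ≥0∞ := fun z => K.indicator (fun w => ENNReal.ofReal (Real.exp (-φ w))) z
    with hgK_def
  have hA : MeasurableSet ({z | U z < θ} ∩ C) := (measurableSet_lt hUm measurable_const).inter hC
  have hGΩ : (fun q : Unit × (↥b × Fin m → ℝ) =>
      (uf ⁻¹' K).indicator (fun w => ENNReal.ofReal (Real.exp (-φ (uf w)))) q.2) = gK ∘ e := by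
    funext q
    show (uf ⁻¹' K).indicator ((fun w => ENNReal.ofReal (Real.exp (-φ w))) ∘ uf) q.2 =
      K.indicator (fun w => ENNReal.ofReal (Real.exp (-φ w))) (uf q.2)
    exact Set.indicator_comp_right uf
  have hpush : (volume : Measure (BlockChartSU N b)).withDensity gK =
      (((Measure.dirac ()).prod volume).withDensity (gK ∘ e)).map e := by
    rw [← withDensity_map_eq_map_withDensity_comp hem hg, he.map_eq]
  -- p590709's END in the frame
  have hL' : 0 < Real.sqrt m * L := by positivity
  have hEND := slotAntiConcentration_restrict_of_sect1Letters (X := Unit) (κ := ↥b × Fin m) (Measure.dirac ())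
    (fun _ => uf ⁻¹' K) (fun _ w => φ (uf w)) (fun _ w => Qf (uf w)) (fun _ w => lin (uf w)) (fun _ w => Vt (uf w))
    (U := fun q => U (e q)) (C := e ⁻¹' C) (Env := e ⁻¹' Env)
    (by rw [hGΩ]; exact hg.comp hem) (hUm.comp hem) (hem hC) (hem hEnv)
    hθ hρ0 hρ1 hρσ hκ hQ0 hL' hd hM hγ₀ hW ?_ ?_ ?_ ?_ ?_ ?_ ?_ ?_ ?_ ?_ ?_ ?_ ?_
  · -- transport the conclusion back to the chart space
    rw [hcard] at hEND
    have hEND' : SlotAntiConcentration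
        (((((Measure.dirac ()).prod (volume : Measure (↥b × Fin m → ℝ))).withDensity (gK ∘ e))).restrict
          (e ⁻¹' ({z | U z < θ} ∩ C)))
        (fun q => U (e q)) θ ρ (3 * ((b.card : ℝ) * m + 1) * (1 + Q) / (κ₀ * (1 - ρ))) := by
      rw [← hGΩ]
      exact hEND
    have hΩ : (((((Measure.dirac ()).prod (volume : Measure (↥b × Fin m → ℝ))).withDensity (gK ∘ e))).restrict
        (e ⁻¹' ({z | U z < θ} ∩ C))) =
        ((Measure.dirac ()).prod volume).withDensity ((({z | U z < θ} ∩ C).indicator gK) ∘ e) := by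
      rw [restrict_withDensity (hem hA), ← withDensity_indicator (hem hA)]
      rfl
    rw [hΩ] at hEND'
    rw [restrict_withDensity hA, ← withDensity_indicator hA]
    -- dag-n21-w3's p602847 BY NAME: drop the `dirac ()` factor, then un-flatten
    have hfib := slotAntiConcentration_of_dirac_prod (volume : Measure (↥b × Fin m → ℝ))
      ((hg.indicator hA).comp hem) hEND'
    exact slotAntiConcentration_blockChartSU_of_unflat b (hg.indicator hA) hUm hfib
  · -- hK: the kept cuts read in the frame are convex (the un-flattening is linear)
    intro _ x hx y hy a c ha hc hac
    show uf (a • x + c • y) ∈ K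
    rw [huf_add, huf_smul, huf_smul]
    exact hK hx hy ha hc hac
  · -- hφ: the exponent read in the frame is convex on them
    intro _
    refine ⟨fun x hx y hy a c ha hc hac => ?_, fun x hx y hy a c ha hc hac => ?_⟩
    · show uf (a • x + c • y) ∈ K
      rw [huf_add, huf_smul, huf_smul]
      exact hK hx hy ha hc hac
    · show φ (uf (a • x + c • y)) ≤ a • φ (uf x) + c • φ (uf y)
      rw [huf_add, huf_smul, huf_smul]
      exact hφ.2 hx hy ha hc hac
  · -- h0K
    intro _
    show uf 0 ∈ K
    rw [huf_zero]
    exact h0K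
  · -- hexp: the (1.2) expansion
    intro _ v hv
    show φ (uf v) = φ (uf 0) + 1 / 2 * Qf (uf v) + lin (uf v) + Vt (uf v)
    rw [huf_zero]
    exact hexp (uf v) hv
  · -- h19: `Σ_q v_q² = Σ_{b′} ‖(uf v) b′‖²`
    intro _ v hv
    rw [hsumsq v]
    exact h19 (uf v) hv
  · -- h16
    intro _ v hv
    exact h16 (uf v) hv
  · -- hV
    intro _ v hv
    exact hV (uf v) hv
  · -- hU: `√d_N·L`-Lipschitz in the frame's sup norm
    intro _ a a'
    show U (uf a) - U (uf a') ≤ Real.sqrt m * L * ‖a - a'‖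
    calc U (uf a) - U (uf a') ≤ L * ‖uf a - uf a'‖ := hU (uf a) (uf a')
      _ = L * ‖uf (a - a')‖ := by rw [huf_sub]
      _ ≤ L * (Real.sqrt m * ‖a - a'‖) := mul_le_mul_of_nonneg_left (hnorm (a - a')) hL.le
      _ = Real.sqrt m * L * ‖a - a'‖ := by ring
  · -- hUc: the centre reads `U 0`
    intro _
    show U (uf 0) ≤ σ * θ
    rw [huf_zero]
    exact hUc
  · -- the clause: `(√d_N·L)² = d_N·L²`
    have hsq : (Real.sqrt m * L) ^ 2 = m * L ^ 2 := by
      rw [mul_pow, Real.sq_sqrt (Nat.cast_nonneg _)]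
    rw [hsq]
    exact hclause
  · -- henv: `e (z, 0 + l • (w − 0)) = l • e (z, w)`
    intro l hl q h1 h2 h3
    rw [hcard] at hl
    show uf ((0 : ↥b × Fin m → ℝ) + l • (q.2 - 0)) ∈ Env
    rw [zero_add, sub_zero, huf_smul]
    exact henv l hl (e q) h1 h2 h3
  · -- hRT: the radial statement moves along the linear map
    intro q h1 h2 h3 s hs h4 h5 h6
    have hes : e (q.1, (0 : ↥b × Fin m → ℝ) + s • (q.2 - 0)) = s • e q := by
      show uf ((0 : ↥b × Fin m → ℝ) + s • (q.2 - 0)) = s • uf q.2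
      rw [zero_add, sub_zero, huf_smul]
    have h4' : θ * (1 - ρ) ≤ U (s • e q) := by simpa only [hes] using h4
    have h5' : U (s • e q) < θ := by simpa only [hes] using h5
    have h6' : s • e q ∈ C := by
      have h6'' : e (q.1, (0 : ↥b × Fin m → ℝ) + s • (q.2 - 0)) ∈ C := h6
      rwa [hes] at h6''
    simpa only [hes] using hRT (e q) h1 h2 h3 s hs h4' h5' h6'
  · -- hQ: the odds, through the measure-preserving frame map
    have hT : MeasurableSet (Env \ ({z | U z < θ} ∩ C)) := hEnv.diff hA
    show (((Measure.dirac ()).prod (volume : Measure (↥b × Fin m → ℝ))).withDensity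
        fun q : Unit × (↥b × Fin m → ℝ) =>
          (uf ⁻¹' K).indicator (fun w => ENNReal.ofReal (Real.exp (-φ (uf w)))) q.2)
        (e ⁻¹' (Env \ ({z | U z < θ} ∩ C))) ≤
      ENNReal.ofReal Q * (((Measure.dirac ()).prod (volume : Measure (↥b × Fin m → ℝ))).withDensity
        fun q : Unit × (↥b × Fin m → ℝ) =>
          (uf ⁻¹' K).indicator (fun w => ENNReal.ofReal (Real.exp (-φ (uf w)))) q.2) (e ⁻¹' ({z | U z < θ} ∩ C))
    rw [hGΩ, ← Measure.map_apply hem hT, ← Measure.map_apply hem hA, ← hpush]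
    exact hQ

end End

end Summit.QuantumFields.YangMills.Theorems.N21LowCentreEndAtSUNBlockChart

end
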